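import Literature.MathematicalPhysics.QuantumFieldTheory.Balaban1983to89.T4TriangularPushforward
import Literature.MathematicalPhysics.QuantumFieldTheory.Balaban1983to89.UnitaryModel
import Literature.MathematicalPhysics.QuantumFieldTheory.Balaban1983to89.AveragingRT
import HarnessLib

/-!
# UV3 ∕ N08 supply — BRANCH (MÖBIUS) EXPANSION: THE ONE-SLOT CANCELLATION ON PRODUCT HAAR `dU_j` (the engine of lemma (M) in the model's letters)

LEAD seat `ym-ust-19936-w1` (gen 12) of crux stmt-QuantumFields-19936 `UnitScaleTilt.HistoryTailL`, cell `ym3-torus`; design note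
`Cruxes/HistoryTailL/HTopBranchExpansion.md` (19936 evidence #49), lemma (M); abstract twin ✓`UV3BranchExpansionKernels.lintegral_prod_translate_slot_eq_of_branches`.
RECORD CURRENCY (★★OWNER WORDS 84∕85): record-independent kinematics; SUPPLY for NODE O B3 (A-rows `fibre55Win`∕`fibre57LowOn`) and Track A's N08 node; read by NO
row and NO concluder of the χ-record `AlphaInputsT3ACv4RecChi`.  Nothing of hTop, of the record, of `HistoryTailL` or of rung R3 is proved here; rung R3 = SU(2) YM₃ on
T³ — NOT d = 4, NOT infinite volume, NOT a mass gap, NOT the Clay problem.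

THE POINT.  Lemma (M) («a constrained set with a MUTE site contributes nothing») reduces, after the model-specific support bookkeeping (F-M2), to: the two branch
integrands `J₁, J₂ : GaugeField P j G → ℝ≥0∞` have the form `J_i U = Ψ (a U · X_i U · U b₀ · b U) U` where the PRIVATE SLOT `b₀ : PBond P j` is read by nothing else —
`Ψ h ·`, `a`, `X_i`, `b` are invariant under `U ↦ U[b₀ ↦ g]` — and then `∫ J₁ dU = ∫ J₂ dU`.  This file is exactly that statement on `fieldMeasure P j G`:
* §1 `extend_single_eq_update` (resampling ONE coordinate is `Function.update`), ★ `lintegral_fieldMeasure_eq_lintegral_prod_update` (`∫ J dU = ∫∫ J(U[b₀ ↦ g]) dU dHaar(g)`,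
  pub-balaban's ✓`measurePreserving_resample` at `κ = Fin 1`), `lintegral_haar_mul_left_mul_right` (`∫ f(c₁·g·c₂) dHaar = ∫ f dHaar`, `HaarData.map_mul_left∕right`).
* §2 ★★★ `lintegral_fieldMeasure_oneSlot_eq` — **`∫ Ψ (a U·X U·U b₀·b U) U dU = ∫∫ Ψ h U dHaar(h) dU`** for every such `X`; ★★★ `lintegral_fieldMeasure_oneSlot_eq_of_branches` —
  two branches `X₁, X₂` ⇒ equal integrals.
[folklore] measure theory; 0 `sorry`, 0 `def`, 0 `instance`; standard axioms.
-/

set_option autoImplicit false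

noncomputable section

open MeasureTheory Function
open scoped ENNReal

namespace Summit.QuantumFields.YangMills.Theorems.UV3BranchExpansionOneSlotField

open Literature.MathematicalPhysics.QuantumFieldTheory.Balaban1983to89
open Literature.MathematicalPhysics.QuantumFieldTheory.Balaban1983to89.T4TriangularPushforward (measurePreserving_resample measurable_resample)

variable {P : Params} {j : ℕ} [DecidableEq (PBond P j)] {G : Type*} [GaugeGroup G] [MeasurableSpace G] [RegularGaugeGroup G] [HaarData G]

/-! ## §1 Resampling one coordinate; translates under Haar -/

omit [GaugeGroup G] [MeasurableSpace G] [RegularGaugeGroup G] [HaarData G] in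
/-- Resampling the single coordinate `b₀` (`κ = Fin 1`) is `Function.update`. [folklore] -/
theorem extend_single_eq_update (b₀ : PBond P j) (U : GaugeField P j G) (g : Fin 1 → G) :
    Function.extend (fun _ : Fin 1 => b₀) g U = update U b₀ (g 0) := by
  classical
  have hβ : Injective (fun _ : Fin 1 => b₀) := fun x y _ => Subsingleton.elim x y
  funext b
  by_cases hb : b = b₀
  · subst hb
    rw [update_self, show b = (fun _ : Fin 1 => b) 0 from rfl, hβ.extend_apply]
  · rw [update_of_ne hb, extend_apply' _ _ _ (fun ⟨c, hc⟩ => hb hc.symm)]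

omit [RegularGaugeGroup G] in
/-- ★ **`∫ J dU = ∫ J(U[b₀ ↦ g]) d(dU ⊗ Haar)(U, g)`**: resampling one coordinate by a fresh Haar variable preserves product Haar (pub-balaban's
✓`measurePreserving_resample` at `κ = Fin 1`, read through `MeasurableEquiv.funUnique`). [folklore] -/
theorem lintegral_fieldMeasure_eq_lintegral_prod_update (b₀ : PBond P j) (J : GaugeField P j G → ℝ≥0∞) (hJ : Measurable J) :
    ∫⁻ U, J U ∂(fieldMeasure P j G) = ∫⁻ p, J (update p.1 b₀ p.2) ∂((fieldMeasure P j G).prod (HaarData.haar : Measure G)) := by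
  haveI := HaarData.isProb (G := G)
  have hβ : Injective (fun _ : Fin 1 => b₀) := fun x y _ => Subsingleton.elim x y
  have hres := measurePreserving_resample (ι := PBond P j) (κ := Fin 1) (HaarData.haar : Measure G) hβ
  -- step 1: resample with a `Fin 1`-indexed fresh coordinate
  have h1 : ∫⁻ U, J U ∂(fieldMeasure P j G) =
      ∫⁻ p, J (update p.1 b₀ (p.2 0)) ∂((fieldMeasure P j G).prod (Measure.pi fun _ : Fin 1 => (HaarData.haar : Measure G))) := by
    have e := hres.lintegral_comp hJ
    have e' : ∫⁻ p, J (update p.1 b₀ (p.2 0)) ∂((fieldMeasure P j G).prod (Measure.pi fun _ : Fin 1 => (HaarData.haar : Measure G))) =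
        ∫⁻ U, J U ∂(fieldMeasure P j G) := by
      refine Eq.trans (lintegral_congr fun p => ?_) e
      show J (update p.1 b₀ (p.2 0)) = J (Function.extend (fun _ : Fin 1 => b₀) p.2 p.1)
      rw [extend_single_eq_update]
    exact e'.symm
  -- step 2: the `Fin 1`-indexed product Haar is Haar (`funUnique`)
  have hfu := (measurePreserving_funUnique (HaarData.haar : Measure G) (Fin 1))
  have hprod : MeasurePreserving (Prod.map id (MeasurableEquiv.funUnique (Fin 1) G))
      ((fieldMeasure P j G).prod (Measure.pi fun _ : Fin 1 => (HaarData.haar : Measure G))) ((fieldMeasure P j G).prod HaarData.haar) :=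
    (MeasurePreserving.id _).prod hfu
  have hJ2 : Measurable fun p : GaugeField P j G × G => J (update p.1 b₀ p.2) := hJ.comp measurable_update'
  rw [h1, ← hprod.lintegral_comp hJ2]
  rfl

/-- `∫ f(c₁·g·c₂) dHaar(g) = ∫ f dHaar` (left and right invariance of `HaarData.haar`). [folklore] -/
theorem lintegral_haar_mul_left_mul_right (f : G → ℝ≥0∞) (hf : Measurable f) (c₁ c₂ : G) :
    ∫⁻ g, f (c₁ * g * c₂) ∂(HaarData.haar : Measure G) = ∫⁻ g, f g ∂(HaarData.haar : Measure G) := by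
  calc ∫⁻ g, f (c₁ * g * c₂) ∂(HaarData.haar : Measure G)
      = ∫⁻ g, (fun h => f (h * c₂)) (c₁ * g) ∂(HaarData.haar : Measure G) := rfl
    _ = ∫⁻ h, (fun h => f (h * c₂)) h ∂((HaarData.haar : Measure G).map fun g => c₁ * g) :=
        (lintegral_map (hf.comp (measurable_mul_const c₂)) (measurable_const_mul c₁)).symm
    _ = ∫⁻ h, f (h * c₂) ∂(HaarData.haar : Measure G) := by rw [HaarData.map_mul_left]
    _ = ∫⁻ k, f k ∂((HaarData.haar : Measure G).map fun h => h * c₂) := (lintegral_map hf (measurable_mul_const c₂)).symm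
    _ = ∫⁻ k, f k ∂(HaarData.haar : Measure G) := by rw [HaarData.map_mul_right]

/-! ## §2 The one-slot cancellation -/

/-- ★★★ **ONE PRIVATE HAAR SLOT LAUNDERS THE BRANCH-DEPENDENT FACTOR**: if `Ψ h ·`, `a`, `X`, `b` do not read the coordinate `b₀`, then
`∫ Ψ (a U · X U · U b₀ · b U) U dU = ∫∫ Ψ h U dHaar(h) dU` — independent of `X`. [folklore] -/
theorem lintegral_fieldMeasure_oneSlot_eq (b₀ : PBond P j) (Ψ : G → GaugeField P j G → ℝ≥0∞) (hΨm : Measurable fun p : G × GaugeField P j G => Ψ p.1 p.2)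
    (hΨ : ∀ h U g, Ψ h (update U b₀ g) = Ψ h U) (a X b : GaugeField P j G → G) (ha : Measurable a) (hX : Measurable X) (hb : Measurable b)
    (ha' : ∀ U g, a (update U b₀ g) = a U) (hX' : ∀ U g, X (update U b₀ g) = X U) (hb' : ∀ U g, b (update U b₀ g) = b U) :
    ∫⁻ U, Ψ (a U * X U * U b₀ * b U) U ∂(fieldMeasure P j G) =
      ∫⁻ p, Ψ p.2 p.1 ∂((fieldMeasure P j G).prod (HaarData.haar : Measure G)) := by
  haveI := HaarData.isProb (G := G)
  have hJ : Measurable fun U : GaugeField P j G => Ψ (a U * X U * U b₀ * b U) U :=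
    hΨm.comp ((((ha.mul hX).mul (measurable_pi_apply b₀)).mul hb).prodMk measurable_id)
  rw [lintegral_fieldMeasure_eq_lintegral_prod_update b₀ _ hJ]
  -- after resampling, the integrand at `(U, g)` is `Ψ (a U · X U · g · b U) U`
  have hpt : ∀ p : GaugeField P j G × G,
      Ψ (a (update p.1 b₀ p.2) * X (update p.1 b₀ p.2) * update p.1 b₀ p.2 b₀ * b (update p.1 b₀ p.2)) (update p.1 b₀ p.2) =
        Ψ (a p.1 * X p.1 * p.2 * b p.1) p.1 := fun p => by
    rw [ha', hX', hb', update_self, hΨ]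
  simp_rw [hpt]
  -- integrate the fresh coordinate first: `∫ Ψ(a·X·g·b, U) dHaar(g) = ∫ Ψ(h, U) dHaar(h)`
  have hm1 : Measurable fun p : GaugeField P j G × G => Ψ (a p.1 * X p.1 * p.2 * b p.1) p.1 :=
    hΨm.comp (((((ha.comp measurable_fst).mul (hX.comp measurable_fst)).mul measurable_snd).mul (hb.comp measurable_fst)).prodMk measurable_fst)
  have hm2 : Measurable fun p : GaugeField P j G × G => Ψ p.2 p.1 := hΨm.comp (measurable_snd.prodMk measurable_fst)
  rw [lintegral_prod _ hm1.aemeasurable, lintegral_prod _ hm2.aemeasurable]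
  refine lintegral_congr fun U => ?_
  exact lintegral_haar_mul_left_mul_right (fun h => Ψ h U) (hΨm.comp (measurable_id.prodMk measurable_const)) (a U * X U) (b U)

/-- ★★★ **TWO BRANCHES, ONE PRIVATE SLOT, EQUAL INTEGRALS** (lemma (M)'s engine in the model's letters): with `Ψ, a, b` as above and two branch factors `X₁, X₂` not
reading `b₀`, `∫ Ψ (a U·X₁ U·U b₀·b U) U dU = ∫ Ψ (a U·X₂ U·U b₀·b U) U dU`. [folklore] -/
theorem lintegral_fieldMeasure_oneSlot_eq_of_branches (b₀ : PBond P j) (Ψ : G → GaugeField P j G → ℝ≥0∞)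
    (hΨm : Measurable fun p : G × GaugeField P j G => Ψ p.1 p.2) (hΨ : ∀ h U g, Ψ h (update U b₀ g) = Ψ h U) (a X₁ X₂ b : GaugeField P j G → G)
    (ha : Measurable a) (hX₁ : Measurable X₁) (hX₂ : Measurable X₂) (hb : Measurable b) (ha' : ∀ U g, a (update U b₀ g) = a U)
    (hX₁' : ∀ U g, X₁ (update U b₀ g) = X₁ U) (hX₂' : ∀ U g, X₂ (update U b₀ g) = X₂ U) (hb' : ∀ U g, b (update U b₀ g) = b U) :
    ∫⁻ U, Ψ (a U * X₁ U * U b₀ * b U) U ∂(fieldMeasure P j G) = ∫⁻ U, Ψ (a U * X₂ U * U b₀ * b U) U ∂(fieldMeasure P j G) := by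
  rw [lintegral_fieldMeasure_oneSlot_eq b₀ Ψ hΨm hΨ a X₁ b ha hX₁ hb ha' hX₁' hb',
    lintegral_fieldMeasure_oneSlot_eq b₀ Ψ hΨm hΨ a X₂ b ha hX₂ hb ha' hX₂' hb']

end Summit.QuantumFields.YangMills.Theorems.UV3BranchExpansionOneSlotField

end
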